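import Literature.MathematicalPhysics.QuantumFieldTheory.Balaban1983to89.B11SectG

/-!
# `Balaban1983to89.B11SectGGlobal` — the block-majorant algebra of [4] (2.51)–(2.56), (2.61) and of [B11] Sect. G (188) in GLOBAL FORM:
# jump-free local SIZES (no cut-offs, no localisation predicate, no cutting cost) and majorants `HasMajG` stated against the whole size
# profile of the input — composition by the kernel product, conversion from the localized form `B11SectG.HasMaj`, the Neumann series

[4] = T. Bałaban, *Propagators and renormalization transformations for lattice gauge theories. II*, Commun. Math. Phys. **96**
(1984) 223–250 [`Balaban1984PropagatorsII`]; [B11] = T. Bałaban, *The variational problem and background fields in renormalization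
group method for lattice gauge theories*, Commun. Math. Phys. **102** (1985) 277–309 [`Balaban1985Variational`]; [B9] = T. Bałaban,
*Propagators for lattice gauge theories in a background field*, Commun. Math. Phys. **99** (1985) 389–434
[`Balaban1985BackgroundPropagators`].

statement-level skeleton of published theorems with citation tags; proofs where landed; nothing here is a claim about the
Yang–Mills mass gap

THE PRINTED LOCI.  [4] (2.51)–(2.53) p. 232: *"|(Tμ)(x)| ≤ K(y,y′)|μ| for x ∈ B(y), supp μ ⊂ B(y′)"* and its USE *"|Tμ| ≤ Σ_{y′} K(y,y′)|μ|_{B(y′)}"*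
(*"Σ_y Δ(y) = I"*); (2.54)–(2.56) p. 233 (composition = convolution of kernels); Lemma 2.1 (2.61) p. 234; [B11] (188) p. 308 (Neumann series);
[B9] (3.43)–(3.45) p. 398: Hölder entries are localised by SMOOTH cut-offs *"ζ ∈ C₀^∞(Δ̃(y))"* ∕ by support — never by a sharp restriction of the OUTPUT.

WHY THIS FILE (cell `pub-ymgap`, node N06; worded WANTED by the knit owner dag-n06-d g12, «kernel piece only, generic, no pins, no schema
re-typing»).  `B11SectG.HasMaj b₁ b₂ T K` quantifies over inputs LOCALIZED in the source class and composes (`hasMaj_comp`) by cutting the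
intermediate vector (`b₂.cut`, cost `b₂.κ`).  For a HÖLDER-type intermediate a sharp cut creates a class-boundary jump which its local size
counts at the pair weight (`B9CoReadingCoordsInputJump`: `(L^k)^γ` — not member-uniform), so in the localized currency a Hölder intermediate is
produced and consumed jointly only through a smooth partition of unity.  THIS FILE types the partition-free GLOBAL form of the same bookkeeping:
* §1 `Size g F` — a family of local sizes `sz y f ≥ 0` (seminorm laws only: `zero ∕ add_le ∕ neg`), read on the UNRESTRICTED vector; NO `cut`,
  NO `IsLoc`, NO `κ`; `BlockNorm.toSize`, the rescaled size `Size.weight W`;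
* §2 ★ `HasMajG s₁ s₂ T K := ∀ f a, s₂.sz a (T f) ≤ Σ_b K a b · s₁.sz b f` ([4] (2.52)–(2.53) taken as the DEFINITION) with its algebra:
  `congr ∕ mono ∕ add ∕ neg ∕ sub ∕ sum`, ★★ `HasMajG.comp` (kernel PRODUCT `Σ_b K₁ a b · K₂ b c` — no cutting cost), `comp_exp` ((2.54) +
  (2.61): `a₁a₂c·e^{−ρd}`), `comp_const`, `weight`, `le_rowSum` (uniform input bound ⇒ output bound);
* §3 conversions: ★★ `hasMajG_of_hasMaj` — EVERY localized majorant with `K ≥ 0` is a global one between the underlying sizes with kernel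
  `K a b · b₁.κ` (this is `B11SectG.HasMaj.bound`); `hasMaj_of_hasMajG` — back to the localized form for a source whose localisation makes its
  size vanish off the block (displayed hypothesis `hvan`; true for the sharp sup classes);
* §4 ★ `neumannG_majorant` — the global twin of `B11SectG.neumann_majorant` ((188) + Lemma 2.1): `A₀ = S + K′∘A₀`, `K′` of majorant `θe^{−δd}`,
  `S` of majorant `Ae^{−ρd}` (`ρ + σ ≤ δ`), `A₀` a priori bounded (`M₀`), `q := θ·c < 1` ⇒ `A₀` has majorant `A(1−q)⁻¹e^{−ρd}` — NO κ anywhere.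
HONEST SCOPE.  Generic finite-dimensional bookkeeping over an abstract `B6.Geometry`; a second currency beside `B11SectG`, not a replacement;
nothing of [4], [B9], [B11] is asserted; no schema of the N06 certificate is re-typed here (that is the schema owner's word); COUNT-NEUTRAL;
N06 NOT discharged; nothing continuum, nothing about the mass gap.  Cell `pub-ymgap` (HUMAN RULING D-0062), Track A node N06 [B9], width seat
`pub-ymgap-dag-n06-w6` (g2), 2026-08-28.
-/

noncomputable section

namespace Literature.MathematicalPhysics.QuantumFieldTheory.Balaban1983to89.B11SectGGlobal

open Finset B6RandomWalk
open B11SectG (BlockNorm HasMaj RowSum conv_exp_le neumann_telescope)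

/-! ## §1 Jump-free local sizes -/

/-- A family of LOCAL SIZES of vectors over the multiscale set 𝔅 = `g.Site`: `sz y f` = the size of `f` near `y`, read on the UNRESTRICTED vector
(e.g. `sup_{Δ̃(y)}|f| + sup {t(z,z′)^{−γ}|f z − f z′| : z ∈ Δ(y)}`), with the seminorm laws only — no cut-offs, no localisation predicate, no
cutting cost (the localized `B11SectG.BlockNorm` carries those for [4]'s *"Σ_y Δ(y) = I"*).
[cite: Balaban1984PropagatorsII, (2.51)–(2.53) p.232; Balaban1985BackgroundPropagators, (3.39)–(3.40) p.397] -/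
structure Size (g : B6.Geometry) (F : Type) [AddCommGroup F] [Module ℝ F] where
  sz : g.Site → F → ℝ
  nonneg : ∀ y f, 0 ≤ sz y f
  zero : ∀ y, sz y 0 = 0
  add_le : ∀ y f f', sz y (f + f') ≤ sz y f + sz y f'
  neg : ∀ y f, sz y (-f) = sz y f

variable {g : B6.Geometry}
variable {F₁ F₂ F₃ : Type} [AddCommGroup F₁] [Module ℝ F₁] [AddCommGroup F₂] [Module ℝ F₂]
  [AddCommGroup F₃] [Module ℝ F₃]

/-- Finite sums: `sz y (Σᵢ fᵢ) ≤ Σᵢ sz y fᵢ`. [cite: Balaban1984PropagatorsII, (2.51) p.232, bookkeeping] -/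
theorem Size.sz_sum_le (s : Size g F₁) (y : g.Site) {ι : Type} (t : Finset ι) (f : ι → F₁) :
    s.sz y (∑ i ∈ t, f i) ≤ ∑ i ∈ t, s.sz y (f i) := by
  classical
  induction t using Finset.induction_on with
  | empty => simp [s.zero]
  | insert i t hi ih =>
      rw [Finset.sum_insert hi, Finset.sum_insert hi]
      exact (s.add_le y _ _).trans (by linarith)

/-- `sz y (f − f′) ≤ sz y f + sz y f′`. [cite: Balaban1984PropagatorsII, (2.51) p.232, bookkeeping] -/
theorem Size.sz_sub_le (s : Size g F₁) (y : g.Site) (f f' : F₁) : s.sz y (f - f') ≤ s.sz y f + s.sz y f' := by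
  rw [sub_eq_add_neg]
  exact (s.add_le y f (-f')).trans (by rw [s.neg])

/-- The size family UNDER a localized block norm (forget `cut`, `IsLoc`, `κ`). [cite: Balaban1984PropagatorsII, (2.51) p.232, dictionary] -/
def _root_.Literature.MathematicalPhysics.QuantumFieldTheory.Balaban1983to89.B11SectG.BlockNorm.toSize (b : BlockNorm g F₁) : Size g F₁ where
  sz := b.loc
  nonneg := b.loc_nonneg
  zero := b.loc_zero
  add_le := b.loc_add_le
  neg := b.loc_neg

/-- `b.toSize.sz = b.loc`. [cite: Balaban1984PropagatorsII, (2.51) p.232, dictionary] -/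
@[simp] theorem toSize_sz (b : BlockNorm g F₁) (y : g.Site) (f : F₁) : b.toSize.sz y f = b.loc y f := rfl

/-- The RESCALED size `W(y)·sz y f`, `W ≥ 0` (the powers `(Lʲη)^{−p}` of (3.42)–(3.47) taken inside the size, p. 398 *"conventional"*).
[cite: Balaban1985BackgroundPropagators, p.398 (remark after (3.47))] -/
def Size.weight (s : Size g F₁) (W : g.Site → ℝ) (hW : ∀ y, 0 ≤ W y) : Size g F₁ where
  sz y f := W y * s.sz y f
  nonneg y f := mul_nonneg (hW y) (s.nonneg y f)
  zero y := by rw [s.zero, mul_zero]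
  add_le y f f' := (mul_le_mul_of_nonneg_left (s.add_le y f f') (hW y)).trans_eq (mul_add _ _ _)
  neg y f := by rw [s.neg]

/-- The rescaled size is `W(y) ×` the size. [cite: Balaban1985BackgroundPropagators, p.398 (remark after (3.47)), bookkeeping] -/
@[simp] theorem Size.weight_sz (s : Size g F₁) (W : g.Site → ℝ) (hW : ∀ y, 0 ≤ W y) (y : g.Site) (f : F₁) :
    (s.weight W hW).sz y f = W y * s.sz y f := rfl

/-- The SUM of two size families (e.g. «sup part + Hölder part» of (3.39)–(3.40)) is a size family. [cite: Balaban1985BackgroundPropagators, (3.39)–(3.40) p.397, bookkeeping] -/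
def Size.add (s s' : Size g F₁) : Size g F₁ where
  sz y f := s.sz y f + s'.sz y f
  nonneg y f := add_nonneg (s.nonneg y f) (s'.nonneg y f)
  zero y := by rw [s.zero, s'.zero, add_zero]
  add_le y f f' := by
    calc s.sz y (f + f') + s'.sz y (f + f') ≤ (s.sz y f + s.sz y f') + (s'.sz y f + s'.sz y f') := add_le_add (s.add_le y f f') (s'.add_le y f f')
      _ = _ := by ring
  neg y f := by rw [s.neg, s'.neg]

/-- The sum size is the sum of the sizes. [cite: Balaban1985BackgroundPropagators, (3.39)–(3.40) p.397, bookkeeping] -/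
@[simp] theorem Size.add_sz (s s' : Size g F₁) (y : g.Site) (f : F₁) : (s.add s').sz y f = s.sz y f + s'.sz y f := rfl

/-! ## §2 Majorants in global form and their algebra -/

/-- ★ **A MAJORANT IN GLOBAL FORM**: the size of `T f` near `a` is bounded by the kernel-weighted size PROFILE of `f` over ALL blocks —
[4]'s *"|Tμ| ≤ Σ_{y′} K(y,y′)|μ|_{B(y′)}"* ((2.52)–(2.53)) taken as the definition; no localisation hypothesis on the input, hence no block-boundary
jump when the sizes are of Hölder type. [cite: Balaban1984PropagatorsII, (2.52)–(2.53) p.232] -/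
def HasMajG (s₁ : Size g F₁) (s₂ : Size g F₂) (T : F₁ →ₗ[ℝ] F₂) (K : g.Site → g.Site → ℝ) : Prop :=
  ∀ (f : F₁) (a : g.Site), s₂.sz a (T f) ≤ ∑ b : g.Site, K a b * s₁.sz b f

/-- Global majorants pass along pointwise-equal operators. [cite: Balaban1984PropagatorsII, (2.52)–(2.53) p.232, bookkeeping] -/
theorem HasMajG.congr {s₁ : Size g F₁} {s₂ : Size g F₂} {T T' : F₁ →ₗ[ℝ] F₂} {K : g.Site → g.Site → ℝ}
    (h : HasMajG s₁ s₂ T K) (hTT' : ∀ f, T f = T' f) : HasMajG s₁ s₂ T' K :=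
  fun f a => by rw [← hTT' f]; exact h f a

/-- Monotonicity in the kernel. [cite: Balaban1984PropagatorsII, (2.52)–(2.53) p.232, bookkeeping] -/
theorem HasMajG.mono {s₁ : Size g F₁} {s₂ : Size g F₂} {T : F₁ →ₗ[ℝ] F₂} {K K' : g.Site → g.Site → ℝ}
    (h : HasMajG s₁ s₂ T K) (hle : ∀ a b, K a b ≤ K' a b) : HasMajG s₁ s₂ T K' :=
  fun f a => (h f a).trans (Finset.sum_le_sum fun b _ => mul_le_mul_of_nonneg_right (hle a b) (s₁.nonneg b f))

/-- The zero operator. [cite: Balaban1984PropagatorsII, (2.52)–(2.53) p.232, bookkeeping] -/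
theorem hasMajG_zero (s₁ : Size g F₁) (s₂ : Size g F₂) : HasMajG s₁ s₂ (0 : F₁ →ₗ[ℝ] F₂) (fun _ _ => 0) := by
  intro f a
  simp [s₂.zero]

/-- *"A summation preserves it also"* ([4] p. 232): global majorants add. [cite: Balaban1984PropagatorsII, p.232] -/
theorem HasMajG.add {s₁ : Size g F₁} {s₂ : Size g F₂} {T₁ T₂ : F₁ →ₗ[ℝ] F₂} {K₁ K₂ : g.Site → g.Site → ℝ}
    (h₁ : HasMajG s₁ s₂ T₁ K₁) (h₂ : HasMajG s₁ s₂ T₂ K₂) : HasMajG s₁ s₂ (T₁ + T₂) (fun a b => K₁ a b + K₂ a b) := by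
  intro f a
  rw [LinearMap.add_apply]
  refine (s₂.add_le a _ _).trans ?_
  calc s₂.sz a (T₁ f) + s₂.sz a (T₂ f) ≤ (∑ b, K₁ a b * s₁.sz b f) + ∑ b, K₂ a b * s₁.sz b f := add_le_add (h₁ f a) (h₂ f a)
    _ = ∑ b, (K₁ a b + K₂ a b) * s₁.sz b f := by rw [← Finset.sum_add_distrib]; exact Finset.sum_congr rfl fun b _ => by ring

/-- Global majorants are insensitive to the sign of the operator. [cite: Balaban1984PropagatorsII, (2.52)–(2.53) p.232, bookkeeping] -/
theorem HasMajG.neg {s₁ : Size g F₁} {s₂ : Size g F₂} {T : F₁ →ₗ[ℝ] F₂} {K : g.Site → g.Site → ℝ} (h : HasMajG s₁ s₂ T K) :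
    HasMajG s₁ s₂ (-T) K := by
  intro f a
  rw [LinearMap.neg_apply, s₂.neg]
  exact h f a

/-- Differences. [cite: Balaban1984PropagatorsII, (2.52)–(2.53) p.232, bookkeeping] -/
theorem HasMajG.sub {s₁ : Size g F₁} {s₂ : Size g F₂} {T₁ T₂ : F₁ →ₗ[ℝ] F₂} {K₁ K₂ : g.Site → g.Site → ℝ}
    (h₁ : HasMajG s₁ s₂ T₁ K₁) (h₂ : HasMajG s₁ s₂ T₂ K₂) : HasMajG s₁ s₂ (T₁ - T₂) (fun a b => K₁ a b + K₂ a b) := by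
  rw [sub_eq_add_neg]
  exact h₁.add h₂.neg

/-- Finite sums of operators. [cite: Balaban1984PropagatorsII, (2.52)–(2.53) p.232, bookkeeping] -/
theorem hasMajG_sum {s₁ : Size g F₁} {s₂ : Size g F₂} (T : ℕ → F₁ →ₗ[ℝ] F₂) (K : ℕ → g.Site → g.Site → ℝ)
    (h : ∀ n, HasMajG s₁ s₂ (T n) (K n)) (N : ℕ) :
    HasMajG s₁ s₂ (∑ n ∈ Finset.range N, T n) (fun a b => ∑ n ∈ Finset.range N, K n a b) := by
  induction N with
  | zero => simpa using hasMajG_zero s₁ s₂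
  | succ N ih =>
      have := ih.add (h N)
      simpa [Finset.sum_range_succ] using this

/-- The identity operator has the Kronecker kernel. [cite: Balaban1984PropagatorsII, (2.52)–(2.53) p.232, bookkeeping] -/
theorem hasMajG_id [DecidableEq g.Site] (s : Size g F₁) : HasMajG s s LinearMap.id (fun a b => if a = b then 1 else 0) := by
  intro f a
  rw [Finset.sum_eq_single a (fun b _ hb => by simp only [if_neg (Ne.symm hb), zero_mul]) (fun ha => (ha (Finset.mem_univ _)).elim)]
  simp

/-- Rates only get worse: `a·e^{−ρ′d} ≤ a·e^{−ρd}` for `ρ ≤ ρ′`, `a ≥ 0`, `d ≥ 0`. [cite: Balaban1984PropagatorsII, (2.52)–(2.53) p.232, bookkeeping] -/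
theorem HasMajG.of_rate_le {s₁ : Size g F₁} {s₂ : Size g F₂} {T : F₁ →ₗ[ℝ] F₂} {a₀ ρ ρ' : ℝ} (hd : ∀ a b : g.Site, 0 ≤ g.dist a b)
    (ha₀ : 0 ≤ a₀) (hρ : ρ ≤ ρ') (h : HasMajG s₁ s₂ T (fun a b => a₀ * Real.exp (-(ρ' * g.dist a b)))) :
    HasMajG s₁ s₂ T (fun a b => a₀ * Real.exp (-(ρ * g.dist a b))) :=
  h.mono fun a b => mul_le_mul_of_nonneg_left (Real.exp_le_exp.mpr (neg_le_neg (mul_le_mul_of_nonneg_right hρ (hd a b)))) ha₀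

/-- A majorant into each of two target sizes is a majorant into their sum. [cite: Balaban1984PropagatorsII, (2.52) p.232, bookkeeping] -/
theorem HasMajG.target_add {s₁ : Size g F₁} {s₂ s₂' : Size g F₂} {T : F₁ →ₗ[ℝ] F₂} {K K' : g.Site → g.Site → ℝ}
    (h : HasMajG s₁ s₂ T K) (h' : HasMajG s₁ s₂' T K') : HasMajG s₁ (s₂.add s₂') T (fun a b => K a b + K' a b) := by
  intro f a
  simp only [Size.add_sz]
  calc s₂.sz a (T f) + s₂'.sz a (T f) ≤ (∑ b, K a b * s₁.sz b f) + ∑ b, K' a b * s₁.sz b f := add_le_add (h f a) (h' f a)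
    _ = ∑ b, (K a b + K' a b) * s₁.sz b f := by rw [← Finset.sum_add_distrib]; exact Finset.sum_congr rfl fun b _ => by ring

/-- A LARGER source size only helps (`K ≥ 0`): a majorant from `s₁` is one from `s₁ + s₁′` and from `s₁′ + s₁`. [cite: Balaban1984PropagatorsII, (2.52) p.232, bookkeeping] -/
theorem HasMajG.source_add {s₁ s₁' : Size g F₁} {s₂ : Size g F₂} {T : F₁ →ₗ[ℝ] F₂} {K : g.Site → g.Site → ℝ}
    (h : HasMajG s₁ s₂ T K) (hK : ∀ a b, 0 ≤ K a b) : HasMajG (s₁.add s₁') s₂ T K ∧ HasMajG (s₁'.add s₁) s₂ T K := by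
  refine ⟨fun f a => (h f a).trans (Finset.sum_le_sum fun b _ => ?_), fun f a => (h f a).trans (Finset.sum_le_sum fun b _ => ?_)⟩
  · exact mul_le_mul_of_nonneg_left (by rw [Size.add_sz]; exact le_add_of_nonneg_right (s₁'.nonneg b f)) (hK a b)
  · exact mul_le_mul_of_nonneg_left (by rw [Size.add_sz]; exact le_add_of_nonneg_left (s₁'.nonneg b f)) (hK a b)

/-- A uniform bound of the kernel-weighted input profile: if every `sz b f ≤ M` and `K ≥ 0` then `sz a (T f) ≤ (Σ_b K a b)·M`.
[cite: Balaban1984PropagatorsII, (2.52)–(2.53) p.232, bookkeeping] -/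
theorem HasMajG.le_of_profile_le {s₁ : Size g F₁} {s₂ : Size g F₂} {T : F₁ →ₗ[ℝ] F₂} {K : g.Site → g.Site → ℝ}
    (h : HasMajG s₁ s₂ T K) (hK : ∀ a b, 0 ≤ K a b) {f : F₁} {M : ℝ} (hM : ∀ b, s₁.sz b f ≤ M) (a : g.Site) :
    s₂.sz a (T f) ≤ (∑ b : g.Site, K a b) * M := by
  rw [Finset.sum_mul]
  exact (h f a).trans (Finset.sum_le_sum fun b _ => mul_le_mul_of_nonneg_left (hM b) (hK a b))

/-- **COMPOSITION IN GLOBAL FORM** ([4] (2.55): *"this property is preserved under the composition"*): `T₂` (kernel `K₂`, `F₁ → F₂`) then `T₁`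
(kernel `K₁ ≥ 0`, `F₂ → F₃`) has the KERNEL PRODUCT `Σ_b K₁ a b · K₂ b c` — no partition of unity, no cutting cost.
[cite: Balaban1984PropagatorsII, (2.52)–(2.55) pp.232–233] -/
theorem HasMajG.comp {s₁ : Size g F₁} {s₂ : Size g F₂} {s₃ : Size g F₃} {T₁ : F₂ →ₗ[ℝ] F₃} {T₂ : F₁ →ₗ[ℝ] F₂}
    {K₁ K₂ : g.Site → g.Site → ℝ} (h₁ : HasMajG s₂ s₃ T₁ K₁) (h₂ : HasMajG s₁ s₂ T₂ K₂) (hK₁ : ∀ a b, 0 ≤ K₁ a b) :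
    HasMajG s₁ s₃ (T₁ ∘ₗ T₂) (fun a c => ∑ b : g.Site, K₁ a b * K₂ b c) := by
  intro f a
  rw [LinearMap.comp_apply]
  calc s₃.sz a (T₁ (T₂ f)) ≤ ∑ b, K₁ a b * s₂.sz b (T₂ f) := h₁ (T₂ f) a
    _ ≤ ∑ b, K₁ a b * ∑ c, K₂ b c * s₁.sz c f := Finset.sum_le_sum fun b _ => mul_le_mul_of_nonneg_left (h₂ f b) (hK₁ a b)
    _ = ∑ c, (∑ b, K₁ a b * K₂ b c) * s₁.sz c f := by
        simp_rw [Finset.mul_sum, Finset.sum_mul]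
        rw [Finset.sum_comm]
        exact Finset.sum_congr rfl fun c _ => Finset.sum_congr rfl fun b _ => by ring

/-- **COMPOSITION WITH RATES, GLOBAL FORM**: `T₁` (`a₁e^{−ρ₁d}`, `F₂ → F₃`) after `T₂` (`a₂e^{−ρ₂d}`, `F₁ → F₂`) has majorant `a₁a₂c·e^{−ρd}` for every
`0 ≤ ρ ≤ ρ₂` with `ρ + σ ≤ ρ₁`, `σ` the rate of Lemma 2.1's row sum — NO cutting cost. [cite: Balaban1984PropagatorsII, (2.54)–(2.56) pp.232–233 + Lemma 2.1 (2.61) p.234] -/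
theorem HasMajG.comp_exp {s₁ : Size g F₁} {s₂ : Size g F₂} {s₃ : Size g F₃} {T₁ : F₂ →ₗ[ℝ] F₃} {T₂ : F₁ →ₗ[ℝ] F₂}
    {a₁ a₂ ρ₁ ρ₂ ρ σ c : ℝ} (htri : Triangle254 g) (hd : ∀ a b : g.Site, 0 ≤ g.dist a b) (hrow : RowSum g σ c)
    (ha₁ : 0 ≤ a₁) (ha₂ : 0 ≤ a₂) (hρ : 0 ≤ ρ) (hρ₂ : ρ ≤ ρ₂) (hρ₁ : ρ + σ ≤ ρ₁)
    (h₁ : HasMajG s₂ s₃ T₁ (fun a b => a₁ * Real.exp (-(ρ₁ * g.dist a b))))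
    (h₂ : HasMajG s₁ s₂ T₂ (fun a b => a₂ * Real.exp (-(ρ₂ * g.dist a b)))) :
    HasMajG s₁ s₃ (T₁ ∘ₗ T₂) (fun a b => a₁ * a₂ * c * Real.exp (-(ρ * g.dist a b))) := by
  refine (h₁.comp h₂ fun a b => mul_nonneg ha₁ (Real.exp_nonneg _)).mono fun a b => ?_
  have hconv := conv_exp_le htri hd hrow hρ hρ₂ hρ₁ a b
  calc ∑ y'' : g.Site, a₁ * Real.exp (-(ρ₁ * g.dist a y'')) * (a₂ * Real.exp (-(ρ₂ * g.dist y'' b)))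
      = a₁ * a₂ * ∑ y'' : g.Site, Real.exp (-(ρ₁ * g.dist a y'')) * Real.exp (-(ρ₂ * g.dist y'' b)) := by
        rw [Finset.mul_sum]; exact Finset.sum_congr rfl fun y'' _ => by ring
    _ ≤ a₁ * a₂ * (c * Real.exp (-(ρ * g.dist a b))) := mul_le_mul_of_nonneg_left hconv (mul_nonneg ha₁ ha₂)
    _ = _ := by ring

/-- Composition with a CONSTANT majorant on the right: `T₁` (`a₁e^{−ρ₁d}`, `ρ₁ ≥ σ`) after `T₂` (the constant `M`) has the constant majorant `a₁Mc`.
[cite: Balaban1984PropagatorsII, (2.55) p.233 + Lemma 2.1 (2.61) p.234, bookkeeping] -/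
theorem HasMajG.comp_const {s₁ : Size g F₁} {s₂ : Size g F₂} {s₃ : Size g F₃} {T₁ : F₂ →ₗ[ℝ] F₃} {T₂ : F₁ →ₗ[ℝ] F₂}
    {a₁ M ρ₁ σ c : ℝ} (hd : ∀ a b : g.Site, 0 ≤ g.dist a b) (hrow : RowSum g σ c) (ha₁ : 0 ≤ a₁) (hM : 0 ≤ M) (hρ₁ : σ ≤ ρ₁)
    (h₁ : HasMajG s₂ s₃ T₁ (fun a b => a₁ * Real.exp (-(ρ₁ * g.dist a b)))) (h₂ : HasMajG s₁ s₂ T₂ (fun _ _ => M)) :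
    HasMajG s₁ s₃ (T₁ ∘ₗ T₂) (fun _ _ => a₁ * M * c) := by
  refine (h₁.comp h₂ fun a b => mul_nonneg ha₁ (Real.exp_nonneg _)).mono fun a b => ?_
  have hrow' : RowSum g ρ₁ c := hrow.mono hd hρ₁
  calc ∑ y'' : g.Site, a₁ * Real.exp (-(ρ₁ * g.dist a y'')) * M = a₁ * M * ∑ y'' : g.Site, Real.exp (-(ρ₁ * g.dist a y'')) := by
        rw [Finset.mul_sum]; exact Finset.sum_congr rfl fun y'' _ => by ring
    _ ≤ a₁ * M * c := mul_le_mul_of_nonneg_left (hrow' a) (mul_nonneg ha₁ hM)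

/-- Moving scale weights between the kernel and the sizes (global form of `B9SectDSup.HasMaj.weight`): `W₂(a)K(a,b) ≤ K′(a,b)W₁(b)` turns a majorant
between `s₁, s₂` into one between the rescaled sizes. [cite: Balaban1985BackgroundPropagators, p.398 (remark after (3.47))] -/
theorem HasMajG.weight {s₁ : Size g F₁} {s₂ : Size g F₂} {T : F₁ →ₗ[ℝ] F₂} {K K' : g.Site → g.Site → ℝ} {W₁ W₂ : g.Site → ℝ}
    (hW₁ : ∀ y, 0 ≤ W₁ y) (hW₂ : ∀ y, 0 ≤ W₂ y) (h : HasMajG s₁ s₂ T K) (hKK' : ∀ a b, W₂ a * K a b ≤ K' a b * W₁ b) :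
    HasMajG (s₁.weight W₁ hW₁) (s₂.weight W₂ hW₂) T K' := by
  intro f a
  simp only [Size.weight_sz]
  calc W₂ a * s₂.sz a (T f) ≤ W₂ a * ∑ b, K a b * s₁.sz b f := mul_le_mul_of_nonneg_left (h f a) (hW₂ a)
    _ = ∑ b, (W₂ a * K a b) * s₁.sz b f := by rw [Finset.mul_sum]; exact Finset.sum_congr rfl fun b _ => by ring
    _ ≤ ∑ b, (K' a b * W₁ b) * s₁.sz b f := Finset.sum_le_sum fun b _ => mul_le_mul_of_nonneg_right (hKK' a b) (s₁.nonneg b f)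
    _ = ∑ b, K' a b * (W₁ b * s₁.sz b f) := Finset.sum_congr rfl fun b _ => by ring

/-! ## §3 Conversions between the localized and the global currency -/

/-- ★★ **EVERY LOCALIZED MAJORANT IS A GLOBAL ONE** (the USE of [4] (2.51): cut the input with the source's partition of unity, pay its cutting
cost `κ₁`): `HasMaj b₁ b₂ T K` with `K ≥ 0` gives `HasMajG b₁.toSize b₂.toSize T (K·κ₁)` — this is `B11SectG.HasMaj.bound`.
[cite: Balaban1984PropagatorsII, (2.51)–(2.53) p.232] -/
theorem hasMajG_of_hasMaj {b₁ : BlockNorm g F₁} {b₂ : BlockNorm g F₂} {T : F₁ →ₗ[ℝ] F₂} {K : g.Site → g.Site → ℝ}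
    (h : HasMaj b₁ b₂ T K) (hK : ∀ a b, 0 ≤ K a b) : HasMajG b₁.toSize b₂.toSize T (fun a b => K a b * b₁.κ) := by
  intro f a
  simp only [toSize_sz]
  refine (h.bound hK f a).trans (le_of_eq (Finset.sum_congr rfl fun b _ => by ring))

/-- For sharp classes (`κ = 1`) the kernel is unchanged. [cite: Balaban1984PropagatorsII, (2.51)–(2.53) p.232, bookkeeping] -/
theorem hasMajG_of_hasMaj_of_κ_eq_one {b₁ : BlockNorm g F₁} {b₂ : BlockNorm g F₂} {T : F₁ →ₗ[ℝ] F₂} {K : g.Site → g.Site → ℝ}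
    (h : HasMaj b₁ b₂ T K) (hK : ∀ a b, 0 ≤ K a b) (hκ : b₁.κ = 1) : HasMajG b₁.toSize b₂.toSize T K := by
  have h' := hasMajG_of_hasMaj h hK
  simp only [hκ, mul_one] at h'
  exact h'

/-- **BACK TO THE LOCALIZED FORM** for a source class whose localisation predicate makes the size VANISH off the block (`hvan`; true for the sharp
sup classes `BlockNorm.ofBlocks`, `cNorm`, and for the sharp-cut input classes, whose `loc` reads the restriction): a global majorant between the
underlying sizes is a localized one with the same kernel. [cite: Balaban1984PropagatorsII, (2.51)–(2.52) p.232] -/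
theorem hasMaj_of_hasMajG {b₁ : BlockNorm g F₁} {b₂ : BlockNorm g F₂} {T : F₁ →ₗ[ℝ] F₂} {K : g.Site → g.Site → ℝ}
    (h : HasMajG b₁.toSize b₂.toSize T K) (hvan : ∀ (y' : g.Site) (μ : F₁), b₁.IsLoc y' μ → ∀ b, b ≠ y' → b₁.loc b μ = 0) :
    HasMaj b₁ b₂ T K := by
  intro y' μ hμ y
  have h1 := h μ y
  simp only [toSize_sz] at h1
  rw [Finset.sum_eq_single y' (fun b _ hb => by rw [hvan y' μ hμ b hb, mul_zero]) (fun hy => (hy (Finset.mem_univ _)).elim)] at h1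
  exact h1

/-- A global majorant between the sizes UNDER two block norms and a localized one compose (first convert, then `HasMajG.comp`): the glue by which
landed localized letters feed a global-form intermediate. [cite: Balaban1984PropagatorsII, (2.52)–(2.55) pp.232–233] -/
theorem HasMajG.comp_hasMaj {b₁ : BlockNorm g F₁} {b₂ : BlockNorm g F₂} {s₃ : Size g F₃} {T₁ : F₂ →ₗ[ℝ] F₃} {T₂ : F₁ →ₗ[ℝ] F₂}
    {K₁ K₂ : g.Site → g.Site → ℝ} (h₁ : HasMajG b₂.toSize s₃ T₁ K₁) (h₂ : HasMaj b₁ b₂ T₂ K₂) (hK₁ : ∀ a b, 0 ≤ K₁ a b)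
    (hK₂ : ∀ a b, 0 ≤ K₂ a b) : HasMajG b₁.toSize s₃ (T₁ ∘ₗ T₂) (fun a c => ∑ b : g.Site, K₁ a b * (K₂ b c * b₁.κ)) :=
  h₁.comp (hasMajG_of_hasMaj h₂ hK₂) hK₁

/-- The other glue: a LOCALIZED letter out of a block norm `b₂` (cutting cost `κ₂`) after a global majorant INTO the size under `b₂` compose to a global
majorant with kernel `Σ_b K₁ a b · κ₂ · K₂ b c` — a landed localized consumer reads a global-form intermediate whenever the intermediate's block norm has
a finite cutting cost (sup-type classes: `κ = 1`). [cite: Balaban1984PropagatorsII, (2.52)–(2.55) pp.232–233] -/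
theorem hasMajG_comp_of_hasMaj_left {s₁ : Size g F₁} {b₂ : BlockNorm g F₂} {b₃ : BlockNorm g F₃} {T₁ : F₂ →ₗ[ℝ] F₃} {T₂ : F₁ →ₗ[ℝ] F₂}
    {K₁ K₂ : g.Site → g.Site → ℝ} (h₁ : HasMaj b₂ b₃ T₁ K₁) (h₂ : HasMajG s₁ b₂.toSize T₂ K₂) (hK₁ : ∀ a b, 0 ≤ K₁ a b) :
    HasMajG s₁ b₃.toSize (T₁ ∘ₗ T₂) (fun a c => ∑ b : g.Site, K₁ a b * b₂.κ * K₂ b c) := by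
  have h := (hasMajG_of_hasMaj h₁ hK₁).comp h₂ fun a b => mul_nonneg (hK₁ a b) b₂.κ_nonneg
  exact h

/-! ## §4 *"(188) and Lemma 2.1"* in global form: the Neumann series without cutting cost -/

/-- ★ **THE NEUMANN SERIES OVER GLOBAL MAJORANTS** (global twin of `B11SectG.neumann_majorant`): if `A₀ = S + K′∘A₀` with `K′` of majorant `θe^{−δd}`,
`S` of majorant `Ae^{−ρd}`, `ρ + σ ≤ δ`, `A₀` a priori of the constant majorant `M₀`, the row sum of Lemma 2.1 at rate `σ` with constant `c`, and
`q := θ·c < 1`, then `A₀` has the DECAYING majorant `A(1 − q)⁻¹e^{−ρd}` — the n-th term `K′ⁿS` has `qⁿAe^{−ρd}` (n uses of (2.54) + (2.61)), the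
remainder `K′ᴺA₀` has `qᴺM₀·(Σ_b sz b f) → 0`.  No cutting cost enters (`q = θc`, not `κθc`).
[cite: Balaban1985Variational, (187)–(190) p.308; Balaban1984PropagatorsII, Lemma 2.1 p.234] -/
theorem neumannG_majorant {s₁ : Size g F₁} {s₂ : Size g F₂} {K' : Module.End ℝ F₂} {S A0 : F₁ →ₗ[ℝ] F₂} {θ A M₀ δ ρ σ c : ℝ}
    (htri : Triangle254 g) (hd : ∀ a b : g.Site, 0 ≤ g.dist a b) (hrow : RowSum g σ c)
    (hθ : 0 ≤ θ) (hA : 0 ≤ A) (hM₀ : 0 ≤ M₀) (hρ : 0 ≤ ρ) (hρδ : ρ + σ ≤ δ)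
    (hK : HasMajG s₂ s₂ K' (fun a b => θ * Real.exp (-(δ * g.dist a b))))
    (hS : HasMajG s₁ s₂ S (fun a b => A * Real.exp (-(ρ * g.dist a b))))
    (hfix : A0 = S + K' ∘ₗ A0) (hap : HasMajG s₁ s₂ A0 (fun _ _ => M₀)) (hq : θ * c < 1) :
    HasMajG s₁ s₂ A0 (fun a b => A * (1 - θ * c)⁻¹ * Real.exp (-(ρ * g.dist a b))) := by
  set q : ℝ := θ * c with hqdef
  intro f a
  have hc : 0 ≤ c := hrow.nonneg a
  have hq0 : 0 ≤ q := mul_nonneg hθ hc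
  have hterm : ∀ n : ℕ, HasMajG s₁ s₂ ((K' ^ n) ∘ₗ S) (fun a b => q ^ n * A * Real.exp (-(ρ * g.dist a b))) := by
    intro n
    induction n with
    | zero =>
        refine hS.congr ?_ |>.mono ?_
        · intro ν; simp
        · intro a b; simp
    | succ n ih =>
        have hstep := HasMajG.comp_exp (s₁ := s₁) (s₂ := s₂) (s₃ := s₂) (T₁ := K') (T₂ := (K' ^ n) ∘ₗ S)
          htri hd hrow hθ (mul_nonneg (pow_nonneg hq0 n) hA) hρ le_rfl hρδ hK ih
        refine (hstep.congr fun ν => ?_).mono fun a b => ?_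
        · simp [pow_succ', Module.End.mul_apply]
        · have : θ * (q ^ n * A) * c = q ^ (n + 1) * A := by rw [hqdef]; ring
          rw [this]
  have hpartial : ∀ N : ℕ, HasMajG s₁ s₂ (∑ n ∈ Finset.range N, (K' ^ n) ∘ₗ S)
      (fun a b => ∑ n ∈ Finset.range N, q ^ n * A * Real.exp (-(ρ * g.dist a b))) := fun N =>
    hasMajG_sum (fun n => (K' ^ n) ∘ₗ S) _ hterm N
  have hrem : ∀ N : ℕ, HasMajG s₁ s₂ ((K' ^ N) ∘ₗ A0) (fun _ _ => q ^ N * M₀) := by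
    intro N
    induction N with
    | zero =>
        refine hap.congr ?_ |>.mono ?_
        · intro ν; simp
        · intro a b; simp
    | succ N ih =>
        have hstep := HasMajG.comp_const (s₁ := s₁) (s₂ := s₂) (s₃ := s₂) (T₁ := K') (T₂ := (K' ^ N) ∘ₗ A0)
          hd hrow hθ (mul_nonneg (pow_nonneg hq0 N) hM₀) (by linarith [hρ, hρδ]) hK ih
        refine (hstep.congr fun ν => ?_).mono fun a b => ?_
        · simp [pow_succ', Module.End.mul_apply]
        · have : θ * (q ^ N * M₀) * c = q ^ (N + 1) * M₀ := by rw [hqdef]; ring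
          rw [this]
  set P : ℝ := ∑ b : g.Site, Real.exp (-(ρ * g.dist a b)) * s₁.sz b f with hP
  set P₀ : ℝ := ∑ b : g.Site, s₁.sz b f with hP₀
  have hPnn : 0 ≤ P := Finset.sum_nonneg fun b _ => mul_nonneg (Real.exp_nonneg _) (s₁.nonneg b f)
  have hP₀nn : 0 ≤ P₀ := Finset.sum_nonneg fun b _ => s₁.nonneg b f
  set C : ℝ := A * (1 - q)⁻¹ * P with hC
  have hgeomC : ∀ N : ℕ, (∑ b : g.Site, (∑ n ∈ Finset.range N, q ^ n * A * Real.exp (-(ρ * g.dist a b))) * s₁.sz b f) ≤ C := by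
    intro N
    have hgeom : ∑ n ∈ Finset.range N, q ^ n ≤ (1 - q)⁻¹ :=
      sum_le_hasSum (Finset.range N) (fun n _ => pow_nonneg hq0 n) (hasSum_geometric_of_lt_one hq0 hq)
    have hrew : ∀ b : g.Site, (∑ n ∈ Finset.range N, q ^ n * A * Real.exp (-(ρ * g.dist a b))) * s₁.sz b f =
        (∑ n ∈ Finset.range N, q ^ n) * (A * (Real.exp (-(ρ * g.dist a b)) * s₁.sz b f)) := fun b => by
      rw [Finset.sum_mul, Finset.sum_mul]
      exact Finset.sum_congr rfl fun n _ => by ring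
    calc (∑ b : g.Site, (∑ n ∈ Finset.range N, q ^ n * A * Real.exp (-(ρ * g.dist a b))) * s₁.sz b f)
        = ∑ b : g.Site, (∑ n ∈ Finset.range N, q ^ n) * (A * (Real.exp (-(ρ * g.dist a b)) * s₁.sz b f)) :=
          Finset.sum_congr rfl fun b _ => hrew b
      _ = (∑ n ∈ Finset.range N, q ^ n) * (A * P) := by rw [hP, Finset.mul_sum, Finset.mul_sum]
      _ ≤ (1 - q)⁻¹ * (A * P) := mul_le_mul_of_nonneg_right hgeom (mul_nonneg hA hPnn)
      _ = C := by rw [hC]; ring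
  have hN : ∀ N : ℕ, s₂.sz a (A0 f) ≤ C + M₀ * P₀ * q ^ N := by
    intro N
    rw [neumann_telescope hfix N f]
    refine (s₂.add_le a _ _).trans (add_le_add ?_ ?_)
    · have h1 := hpartial N f a
      rw [LinearMap.sum_apply] at h1
      simp only [LinearMap.comp_apply] at h1
      exact h1.trans (hgeomC N)
    · have h2 := hrem N f a
      rw [LinearMap.comp_apply] at h2
      calc s₂.sz a ((K' ^ N) (A0 f)) ≤ ∑ b : g.Site, q ^ N * M₀ * s₁.sz b f := h2
        _ = M₀ * P₀ * q ^ N := by rw [hP₀, Finset.mul_sum, Finset.sum_mul]; exact Finset.sum_congr rfl fun b _ => by ring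
  have hlim : Filter.Tendsto (fun N : ℕ => C + M₀ * P₀ * q ^ N) Filter.atTop (nhds (C + M₀ * P₀ * 0)) :=
    ((tendsto_pow_atTop_nhds_zero_of_lt_one hq0 hq).const_mul (M₀ * P₀)).const_add C
  rw [mul_zero, add_zero] at hlim
  have hfin : s₂.sz a (A0 f) ≤ C := ge_of_tendsto' hlim hN
  calc s₂.sz a (A0 f) ≤ C := hfin
    _ = ∑ b : g.Site, A * (1 - q)⁻¹ * Real.exp (-(ρ * g.dist a b)) * s₁.sz b f := by
        rw [hC, hP, Finset.mul_sum]; exact Finset.sum_congr rfl fun b _ => by ring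

end Literature.MathematicalPhysics.QuantumFieldTheory.Balaban1983to89.B11SectGGlobal
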